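import Summits.QuantumFields.YangMills.Theorems.Instrument.ClosedComplexTailBound
import HarnessLib

/-!
# Instrument cell `ym-instrument`, crew (b): DEFINITIONS for the (G1) free-link polymer class of the `b = 2` axially decimated SU(2) Wilson action
# (S2-SPEC v0.5.1 §1 ∕ §1a; RADIUS-DERIVATION v0.6.1 (7.1)–(7.2)) — axis ∕ free links, the pinned (G1) polymer count, and the (G1) Kotecký–Preiss criterion `KPCriterionFreeSU2`

QUESTIONS.md: Q-B2 ∕ J-B2a (A-0826-25, A-0826-32; sc-plan g2 2026-08-27T00:46:21Z ask (b″)); cell `run/shared/lean/pub/ym-instrument/`, HUMAN RULING D-0084 (2), director-ym R138.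
DEFINITIONS ONLY — this file certifies nothing.  HONEST FRAMING (page 1, binding).  WHAT IS DEFINED HERE AND AT WHICH `(G, D, L, β)`: `G = SU(2)`, `D = 4` (`ℤ⁴`, infinite
volume; the finite-torus reading (β-torus) of S2-SPEC §0 is NOT typed here), Wilson action; the `b = 2` axial comb gauge of S2-SPEC §1 (Lemma G): AXIS LINKS `(x, μ)` with `x_ν`
even for every `ν ≠ μ` (the corner-line links, frozen to `1` resp. to the block field `V`), FREE LINKS = all others (Haar-integrated).  (G1) POLYMERS (S2-SPEC §1a): finite plaquette
sets connected through shared FREE links (`AdmissibleLinkComplexCount.IsAdmConnected IsFreeLink`) with every free link of the set in `≥ 2` of its plaquettes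
(`ClosedComplexTailBound.AdmClosed IsFreeLink`); `freePolymerCount f n` = their number with `n` plaquettes through the free link `f` (the `N_α(n; f)` of RADIUS-DERIVATION (7.2);
bounded for EVERY `n` by the typed T2′ `ClosedComplexTailBound.admClosedCount_le_T2`).  THE CRITERION `KPCriterionFreeSU2 δ β₀W` = RADIUS-DERIVATION (7.2) with the SUP activity
column and a slack `δ` per plaquette: ONE `a > 0` such that for every `0 ≤ β_W ≤ β₀W` and EVERY free link `f` the pinned series converges and
`Σ_n freePolymerCount f n · activitySupSU2(β_W)^n · e^{(a + δ) n} ≤ a/2` (weights `a(X) = (a/2)·#free(X) ≤ a|X|`, `a(f) = a/2`; the paper's «max over root classes `S̄`» becomes «for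
every free link `f`»).  WHAT THIS IS NOT: a `Prop`, never asserted here; its MEANING — Kotecký–Preiss convergence of the comb-gauge cluster expansion of `log W(V)` uniformly in the
block field `V` (RADIUS-DERIVATION (7.2) CONCLUSION, KP86 Thm 1; sc-ref PASS 2026-08-27T01:12:50Z) — is PAPER-LEVEL and NOT a tree theorem; no clustering, no mass gap, no statement about
the decimated action's remainder by itself (that is the reftable row's business, S2-SPEC §3); not summit-bearing.
-/

noncomputable section

open Literature.MathematicalPhysics.QuantumLattice (ZdEdge ZdPlaquette plaquetteEdges)
open Literature.MathematicalPhysics.QuantumFieldTheory.Balaban1983to89.StrongCouplingKPWindow (links activitySupSU2)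
open Summit.QuantumFields.YangMills.Theorems.Instrument.AdmissibleLinkComplexCount (IsAdmConnected)
open Summit.QuantumFields.YangMills.Theorems.Instrument.ClosedComplexTailBound (AdmClosed)

namespace Summit.QuantumFields.YangMills.Theorems.Instrument.FreeLinkPolymerDefs

/-- **Axis link** of the `b = 2` axial comb gauge (S2-SPEC §1): the link `(x, μ)` is an axis link when `x_ν` is even for every `ν ≠ μ` (it lies on a corner line `2y + ℝe_μ`;
these are the first and second links `(2y, μ)`, `(2y + e_μ, μ)` of the corner lines).  PARITY FRAME: the block pattern of the tree's `GaugeBlockAveraging.axial 2 S` with block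
corners at the EVEN sites `2y` (origin of the pattern at `0`); every statement below is invariant under the translations by `2ℤ⁴` that preserve it.  Decidable by unfolding (`abbrev`).
[folklore] -/
abbrev IsAxisLink (e : ZdEdge 4) : Prop := ∀ ν : Fin 4, ν ≠ e.2 → Even (e.1 ν)

/-- **Free link** of the comb gauge (S2-SPEC §1): a link that is not an axis link, i.e. `(x, μ)` with SOME transverse coordinate `x_ν`, `ν ≠ μ`, odd (`isFreeLink_iff`) — the
Haar-integrated variables of Lemma G. [folklore] -/
abbrev IsFreeLink (e : ZdEdge 4) : Prop := ¬ IsAxisLink e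

/-- `(x, μ)` is free iff some transverse coordinate is odd (sc-ref's form (i), 2026-08-27T01:44:10Z). [folklore] -/
theorem isFreeLink_iff (e : ZdEdge 4) : IsFreeLink e ↔ ∃ ν : Fin 4, ν ≠ e.2 ∧ Odd (e.1 ν) := by
  simp only [IsFreeLink, IsAxisLink, not_forall, Int.not_even_iff_odd, exists_prop]

/-- **The pinned (G1) polymer count** `N_α(n; f)` (RADIUS-DERIVATION (7.2), S2-SPEC (G3)): the number of `n`-plaquette sets of `ℤ⁴` containing the link `f`, connected through
shared FREE links, with every free link of the set in at least two of its plaquettes (axis links unconstrained).  A `Nat.card` (the set is finite: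
`ClosedComplexTailBound.admClosedCount_eq_card`); intended for free `f`. [folklore] -/
def freePolymerCount (f : ZdEdge 4) (n : ℕ) : ℕ :=
  Nat.card {X : Finset (ZdPlaquette 4) // X.card = n ∧ f ∈ links X ∧ IsAdmConnected IsFreeLink X ∧ AdmClosed IsFreeLink X}

/-- **The (G1) Kotecký–Preiss criterion for the comb-gauge polymer gas of SU(2), `D = 4`** (RADIUS-DERIVATION v0.6.1 (7.2), sup activity column, slack `δ` per plaquette; a `Prop`,
never asserted here): ONE `a > 0` such that for every Wilson coupling `0 ≤ β_W ≤ β₀W` and EVERY free link `f` the pinned series converges and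
`Σ_n freePolymerCount f n · (activitySupSU2 β_W)^n · e^{(a + δ) n} ≤ a/2` — the KP hypothesis for the zero-activity link polymer `f`.  REDUCTION TO (7.2) (paper, sc-ref
2026-08-27T01:44:10Z (iii)): weights `a(X) := (a/2)·#free(X) ≤ a·|X|` because `#free(X) ≤ ½·Σ_{p∈X} #free(p) ≤ 2|X|` (each free link of an admissible `X` lies in `≥ 2` of its
plaquettes, `AdmClosed`; a plaquette has `4` links), `a(f) = a/2`; incompatibility = a shared FREE link, so for a polymer `X` KP's `Σ_{X′ ≁ X} ≤ Σ_{f ∈ free(X)} Σ_{X′ ∋ f} ≤ #free(X)·a/2 = a(X)`;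
the slack `δ` enters as `e^{δ|X|}` (rate reading `c = 4δ`, R′, exactly as in the closed-complex rows); `|z(X; V)| ≤ activitySupSU2(β_W)^{|X|}` pointwise in `V` (sup column).  MEANING
(paper-level, NOT a tree theorem): KP86 Thm 1 ⇒ the comb-gauge cluster expansion of `log W(V)` converges absolutely, uniformly in the block field `V`. [folklore] -/
def KPCriterionFreeSU2 (δ β₀W : ℝ) : Prop :=
  ∃ a : ℝ, 0 < a ∧ ∀ βW : ℝ, 0 ≤ βW → βW ≤ β₀W → ∀ f : ZdEdge 4, IsFreeLink f →
    Summable (fun n : ℕ => (freePolymerCount f n : ℝ) * activitySupSU2 βW ^ n * Real.exp ((a + δ) * n)) ∧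
    ∑' n : ℕ, (freePolymerCount f n : ℝ) * activitySupSU2 βW ^ n * Real.exp ((a + δ) * n) ≤ a / 2

/-- The criterion is monotone in the window: a certificate at `β₀W` is a certificate at every `β₀W' ≤ β₀W`. [folklore] -/
theorem KPCriterionFreeSU2.mono {δ β₀W β₀W' : ℝ} (h : KPCriterionFreeSU2 δ β₀W) (hle : β₀W' ≤ β₀W) : KPCriterionFreeSU2 δ β₀W' := by
  obtain ⟨a, ha, hall⟩ := h
  exact ⟨a, ha, fun βW h0 h1 => hall βW h0 (h1.trans hle)⟩

/-- Unfolding lemma for `freePolymerCount`. [folklore] -/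
theorem freePolymerCount_def (f : ZdEdge 4) (n : ℕ) : freePolymerCount f n =
    Nat.card {X : Finset (ZdPlaquette 4) // X.card = n ∧ f ∈ links X ∧ IsAdmConnected IsFreeLink X ∧ AdmClosed IsFreeLink X} := rfl

/-- The root link `((0,0,0,0), 0)`'s neighbour `((1,0,0,0)… )` — sanity check that free links exist: `((0,…,0) + e₁, 0)` (odd first transverse coordinate) is free. [folklore] -/
theorem isFreeLink_example : IsFreeLink ((Pi.single 1 1 : Fin 4 → ℤ), (0 : Fin 4)) := by
  decide

end Summit.QuantumFields.YangMills.Theorems.Instrument.FreeLinkPolymerDefs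

end
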